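import Summits.HubbardSuperconductivity.HubbardSuperconductivity.Theorems.AposterioriCapRgSsbToEvenTorusLroGlue
import Summits.HubbardSuperconductivity.HubbardSuperconductivity.Theorems.AposterioriCapRgSsbToEvenTorusLroFacePurityOfRepelledOrder
import HarnessLib

/-!
# Crux `SsbToEvenTorusLro` (stmt-HubbardSuperconductivity-1315), line `pair-yrast-landau-floor` — glue, door 2:
# the crux from REPELLED ORDER PERSISTENCE + the pair-yrast floor (companion of `…Glue.lean`)

With the landed reduction `facePurity_of_repelledOrderAt` / `stub_facePurity_of_repelledOrderPersistence` (p90057: the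
Cw line's S1/S3/S4/S5 + Griffiths recentring + `deriv_of_chord`) and the landed composition of `…Glue.lean` (p90864), the
`R`-uniform repelled-order floor (ROP — the `∀ U > 0, δ ∈ (0,1)` form of the sibling crux stmt-10439's open stub
`stub_repelledOrderPersistence`) replaces derivative face purity in the line: POINTWISE
`DM ∧ ROP-floor(U,μ) ∧ Y(U,δ) ⇒ HasDWavePairFieldLROAt U δ`, its minimal-infrared twin with the ceiling, and the crux BY NAME from
the two registered open stubs `stub_repelledOrderPersistence` ∧ `stub_pairYrastFloor` (door 2 of the skeleton
`Cruxes/SsbToEvenTorusLro/Lines/pair_yrast_landau_floor.lean`). Folklore bookkeeping on the literal route terms; no definition.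
-/

noncomputable section

namespace Summit.HubbardSuperconductivity.HubbardSuperconductivity.Theorems

-- summit = problem name (single-conjunct summit), D-0017
set_option linter.dupNamespace false

open Literature.MathematicalPhysics.QuantumLattice Literature.Probability.LatticeModels
open Literature.Barriers.HubbardSuperconductivity (HasDWavePairFieldLROAt)
open Filter Set Matrix
open scoped ComplexOrder ComplexConjugate
open Summit.HubbardSuperconductivity.HubbardSuperconductivity.Theses.AposterioriCapRg (SsbToEvenTorusLro)
open Summit.HubbardSuperconductivity.WcbcsSsbToTorusLRO.Negative
  (floor_of_deriv_of_leak hasDWavePairFieldLROAt_of_floor)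

/-! ## Pointwise -/

/-- **DM ∧ ROP-floor(U,μ) ∧ Y(U,δ) ⇒ the summit matrix at `(U, δ)`** for `U > 0`, `δ ∈ (0,1)`: density matching at
`μ`, an `R`-uniform repelled-order floor at `(U, μ)` (the body of `stub_repelledOrderPersistence`) and the pair-yrast
floor at `(U, δ)` give `HasDWavePairFieldLROAt U δ` — through the landed reduction `facePurity_of_repelledOrderAt`
(Cw stubs S1/S3/S4/S5 + Griffiths recentring + `deriv_of_chord`). No order hypothesis is consumed here: it is
consumed by whoever supplies the two floors. [folklore] -/
theorem hasDWavePairFieldLROAt_of_repelledOrderAt_of_pairYrastFloorAt {U δ μ : ℝ} (hU : 0 < U)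
    (hδ : δ ∈ Set.Ioo (0:ℝ) 1)
    (hdm : Filter.Tendsto (fun L : ℕ => ((hubbardTorusWith 2 (L + 1) 1 U μ).groundStateFunctional totalNumber).re / ((L + 1 : ℕ) : ℝ) ^ 2) Filter.atTop (nhds (1 - δ)))
    (hBa : ∃ a : ℝ, 0 < a ∧ ∀ R : ℕ, 0 < R → ∃ κ : ℝ, 0 < κ ∧ ∃ h₀ : ℝ, 0 < h₀ ∧ ∀ h ∈ Set.Ioo (0:ℝ) h₀, ∀ᶠ L : ℕ in Filter.atTop, a ≤ ((dWaveSourceTorus (L + 1) U μ h + (κ : ℂ) • (((((R : ℝ) ^ 4)⁻¹ : ℝ) : ℂ) • ∑ a : Literature.Probability.LatticeModels.TorusSite 2 (L + 1), (∑ u : Fin 2 → Fin R, localPair dWaveFormFactor (L + 1) (a + fun i => ((u i : ℕ) : ZMod (L + 1))))ᴴ * (∑ u : Fin 2 → Fin R, localPair dWaveFormFactor (L + 1) (a + fun i => ((u i : ℕ) : ZMod (L + 1)))))).groundStateFunctional (pairField dWaveFormFactor (L + 1))).re / ((L + 1 : ℕ) : ℝ) ^ 2)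
    (hYat : ∃ c α η M₀ : ℝ, 0 < c ∧ α < 2 ∧ 0 < η ∧ ∀ᶠ k : ℕ in Filter.atTop, ∀ ψ : Fock (Orb (FermionTorus 2 (2 * k + 1 + 1))), IsGroundStateInSector (hubbardTorus 2 (2 * k + 1 + 1) 1 U) (2 * ⌊(1 - δ) * ((2 * k + 1 + 1 : ℕ) : ℝ) ^ 2 / 2⌋₊) 0 ψ → star ψ ⬝ᵥ ψ = 1 → ∀ m : TorusSite 2 (2 * k + 1 + 1), m ≠ 0 → momentumNormSq (2 * k + 1 + 1) m ≤ η ^ 2 → ∃ μ' : ℝ, |μ'| ≤ M₀ ∧ ∀ E : ℝ, hubbardTorusWith 2 (2 * k + 1 + 1) 1 U μ' *ᵥ ψ = (E : ℂ) • ψ → (E + c * momentumNormSq (2 * k + 1 + 1) m ^ (α / 2)) * (star (pairFieldAt dWaveFormFactor (2 * k + 1 + 1) m *ᵥ ψ) ⬝ᵥ (pairFieldAt dWaveFormFactor (2 * k + 1 + 1) m *ᵥ ψ)).re ≤ (star (pairFieldAt dWaveFormFactor (2 * k + 1 + 1) m *ᵥ ψ) ⬝ᵥ (hubbardTorusWith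 2 (2 * k + 1 + 1) 1 U μ' *ᵥ (pairFieldAt dWaveFormFactor (2 * k + 1 + 1) m *ᵥ ψ))).re ∧ (E + c * momentumNormSq (2 * k + 1 + 1) m ^ (α / 2)) * (star ((pairFieldAt dWaveFormFactor (2 * k + 1 + 1) m)ᴴ *ᵥ ψ) ⬝ᵥ ((pairFieldAt dWaveFormFactor (2 * k + 1 + 1) m)ᴴ *ᵥ ψ)).re ≤ (star ((pairFieldAt dWaveFormFactor (2 * k + 1 + 1) m)ᴴ *ᵥ ψ) ⬝ᵥ (hubbardTorusWith 2 (2 * k + 1 + 1) 1 U μ' *ᵥ ((pairFieldAt dWaveFormFactor (2 * k + 1 + 1) m)ᴴ *ᵥ ψ))).re) :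
    HasDWavePairFieldLROAt U δ :=
  hasDWavePairFieldLROAt_of_facePurityAt_of_pairYrastFloorAt hU (facePurity_of_repelledOrderAt hδ hdm hBa) hYat

/-- **DM ∧ ROP-floor(U,μ) ∧ infrared ceiling(U,δ) ⇒ the summit matrix at `(U, δ)`** (`δ ∈ (0,1)`): the minimal-infrared
twin of the previous theorem. [folklore] -/
theorem hasDWavePairFieldLROAt_of_repelledOrderAt_of_infraredCeilingAt {U δ μ : ℝ}
    (hδ : δ ∈ Set.Ioo (0:ℝ) 1)
    (hdm : Filter.Tendsto (fun L : ℕ => ((hubbardTorusWith 2 (L + 1) 1 U μ).groundStateFunctional totalNumber).re / ((L + 1 : ℕ) : ℝ) ^ 2) Filter.atTop (nhds (1 - δ)))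
    (hBa : ∃ a : ℝ, 0 < a ∧ ∀ R : ℕ, 0 < R → ∃ κ : ℝ, 0 < κ ∧ ∃ h₀ : ℝ, 0 < h₀ ∧ ∀ h ∈ Set.Ioo (0:ℝ) h₀, ∀ᶠ L : ℕ in Filter.atTop, a ≤ ((dWaveSourceTorus (L + 1) U μ h + (κ : ℂ) • (((((R : ℝ) ^ 4)⁻¹ : ℝ) : ℂ) • ∑ a : Literature.Probability.LatticeModels.TorusSite 2 (L + 1), (∑ u : Fin 2 → Fin R, localPair dWaveFormFactor (L + 1) (a + fun i => ((u i : ℕ) : ZMod (L + 1))))ᴴ * (∑ u : Fin 2 → Fin R, localPair dWaveFormFactor (L + 1) (a + fun i => ((u i : ℕ) : ZMod (L + 1)))))).groundStateFunctional (pairField dWaveFormFactor (L + 1))).re / ((L + 1 : ℕ) : ℝ) ^ 2)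
    (hC : ∃ A α η : ℝ, α < 2 ∧ 0 < η ∧ ∀ᶠ k : ℕ in Filter.atTop, ∀ ψ : Fock (Orb (FermionTorus 2 (2 * k + 1 + 1))), IsGroundStateInSector (hubbardTorus 2 (2 * k + 1 + 1) 1 U) (2 * ⌊(1 - δ) * ((2 * k + 1 + 1 : ℕ) : ℝ) ^ 2 / 2⌋₊) 0 ψ → star ψ ⬝ᵥ ψ = 1 → ∀ m : TorusSite 2 (2 * k + 1 + 1), m ≠ 0 → momentumNormSq (2 * k + 1 + 1) m ≤ η ^ 2 → pairStructureFactor dWaveFormFactor (2 * k + 1 + 1) ψ m ≤ A * (momentumNormSq (2 * k + 1 + 1) m ^ (α / 2))⁻¹) :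
    HasDWavePairFieldLROAt U δ :=
  hasDWavePairFieldLROAt_of_facePurityAt_of_infraredCeilingAt (facePurity_of_repelledOrderAt hδ hdm hBa) hC

/-! ## The crux BY NAME (door 2 of the skeleton) -/

/-- **Crux glue, door 2: (ROP) ∧ (Y) ⇒ `SsbToEvenTorusLro`.** The hypotheses are VERBATIM the registered open stubs
`stub_repelledOrderPersistence` (the `∀ U > 0, δ ∈ (0,1)` form of the Cw line's S2) and `stub_pairYrastFloor`.
[folklore] -/
theorem SsbToEvenTorusLro_of_repelledOrder_of_pairYrastFloor :
    (∀ (U δ μ : ℝ), 0 < U → δ ∈ Set.Ioo (0:ℝ) 1 → Filter.Tendsto (fun L : ℕ => ((hubbardTorusWith 2 (L + 1) 1 U μ).groundStateFunctional totalNumber).re / ((L + 1 : ℕ) : ℝ) ^ 2) Filter.atTop (nhds (1 - δ)) → HasDWaveOrder U μ → ∃ a : ℝ, 0 < a ∧ ∀ R : ℕ, 0 < R → ∃ κ : ℝ, 0 < κ ∧ ∃ h₀ : ℝ, 0 < h₀ ∧ ∀ h ∈ Set.Ioo (0:ℝ) h₀, ∀ᶠ L : ℕ in Filter.atTop, a ≤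 ((dWaveSourceTorus (L + 1) U μ h + (κ : ℂ) • (((((R : ℝ) ^ 4)⁻¹ : ℝ) : ℂ) • ∑ a : Literature.Probability.LatticeModels.TorusSite 2 (L + 1), (∑ u : Fin 2 → Fin R, localPair dWaveFormFactor (L + 1) (a + fun i => ((u i : ℕ) : ZMod (L + 1))))ᴴ * (∑ u : Fin 2 → Fin R, localPair dWaveFormFactor (L + 1) (a + fun i => ((u i : ℕ) : ZMod (L + 1)))))).groundStateFunctional (pairField dWaveFormFactor (L + 1))).re / ((L + 1 : ℕ) : ℝ) ^ 2) →
    (∀ (U δ μ : ℝ), 0 < U → δ ∈ Set.Ioo (0:ℝ) 1 → Filter.Tendsto (fun L : ℕ => ((hubbardTorusWith 2 (L + 1) 1 U μ).groundStateFunctional totalNumber).re / ((L + 1 : ℕ) : ℝ) ^ 2) Filter.atTop (nhds (1 - δ)) → HasDWaveOrder U μ → ∃ c α η M₀ : ℝ, 0 < c ∧ α < 2 ∧ 0 < η ∧ ∀ᶠ k : ℕ in Filter.atTop, ∀ ψ : Fock (Orb (FermionTorus 2 (2 * k + 1 + 1))), IsGroundStateInSector (hubbardTorus 2 (2 * k +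 1 + 1) 1 U) (2 * ⌊(1 - δ) * ((2 * k + 1 + 1 : ℕ) : ℝ) ^ 2 / 2⌋₊) 0 ψ → star ψ ⬝ᵥ ψ = 1 → ∀ m : TorusSite 2 (2 * k + 1 + 1), m ≠ 0 → momentumNormSq (2 * k + 1 + 1) m ≤ η ^ 2 → ∃ μ' : ℝ, |μ'| ≤ M₀ ∧ ∀ E : ℝ, hubbardTorusWith 2 (2 * k + 1 + 1) 1 U μ' *ᵥ ψ = (E : ℂ) • ψ → (E + c * momentumNormSq (2 * k + 1 + 1) m ^ (α / 2)) * (star (pairFieldAt dWaveFormFactor (2 * k + 1 + 1) m *ᵥ ψ) ⬝ᵥ (pairFieldAt dWaveFormFactor (2 * k + 1 + 1) m *ᵥ ψ)).re ≤ (star (pairFieldAt dWaveFormFactor (2 * k + 1 + 1) m *ᵥ ψ) ⬝ᵥ (hubbardTorusWith 2 (2 * k + 1 + 1) 1 U μ' *ᵥ (pairFieldAt dWaveFormFactor (2 * k + 1 + 1) m *ᵥ ψ))).re ∧ (E + c * momentumNormSq (2 * k + 1 + 1) m ^ (α / 2)) * (star ((pairFieldAt dWaveFormFactor (2 * k + 1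 + 1) m)ᴴ *ᵥ ψ) ⬝ᵥ ((pairFieldAt dWaveFormFactor (2 * k + 1 + 1) m)ᴴ *ᵥ ψ)).re ≤ (star ((pairFieldAt dWaveFormFactor (2 * k + 1 + 1) m)ᴴ *ᵥ ψ) ⬝ᵥ (hubbardTorusWith 2 (2 * k + 1 + 1) 1 U μ' *ᵥ ((pairFieldAt dWaveFormFactor (2 * k + 1 + 1) m)ᴴ *ᵥ ψ))).re) →
    SsbToEvenTorusLro :=
  fun hROP hY U δ μ hU hδ hdm hO =>
    hasDWavePairFieldLROAt_of_repelledOrderAt_of_pairYrastFloorAt hU hδ hdm (hROP U δ μ hU hδ hdm hO)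
      (hY U δ μ hU hδ hdm hO)

end Summit.HubbardSuperconductivity.HubbardSuperconductivity.Theorems
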